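import Mathlib
import Summits.Ventures.DiscreteObjects.Mahler.QuarticCensusTools
import Summits.Ventures.DiscreteObjects.Mahler.SalemStructure
import Summits.Ventures.DiscreteObjects.Mahler.SchinzelTotallyReal

/-!
# Monic palindromic irreducible quartics have `M = 1` or `M ≥ 1.3248` (venture `DiscreteObjects`, target L)

Cell `pub-namedobj`, seat `pub-namedobj-mahler` (gen 10). Framing: lottery ticket; floor = certified
bounds/negative ranges.

`palindromic_quartic_measure`: an irreducible monic palindromic `m = x⁴ + ax³ + bx² + ax + 1 ∈ ℤ[x]`
cannot have `1 < M(m) < 1.3248` (the true minimum over such `m` with `M > 1` is the Salem number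
`1.7221`; we prove what the census row `DegreeCensus 4 1.3248 []` needs).  The four roots are distinct
and closed under `β ↦ β⁻¹`, `β ↦ β̄`; cases:
* a unimodular root exists (Salem case): the dominant root `τ` is real (`salem_structure_of_irreducible`)
  and `1 ≤ |m(±1)| ≤ 4(|τ|-1)²/|τ|`, impossible for `|τ| < 1.3248`;
* no unimodular root, two real dominant roots: all roots real, Schinzel's theorem gives `M ≥ φ²`;
* no unimodular root, a conjugate pair `α, ᾱ` outside: `y = α + α⁻¹` is a non-real root of
  `y² + ay + (b-2)`, so `Im(y)² ≥ 3/4`, while `Im(y)² ≤ (|α|² - 1)²/|α|² < 3/4`.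
-/

namespace Summit.Ventures.DiscreteObjects.Mahler

open Polynomial
open scoped ComplexConjugate

/-- **Monic palindromic irreducible quartics have `M = 1` or `M ≥ 1.3248`** (in fact `≥ 1.722`; we
prove what the census row needs). -/
theorem palindromic_quartic_measure {m : ℤ[X]} (hirr : Irreducible m) (hdeg : m.natDegree = 4)
    (hmonic : m.Monic) (hrev : m.reverse = m) (h1 : 1 < intMahlerMeasure m)
    (h2 : intMahlerMeasure m < 13248 / 10000) : False := by
  classical
  have hm0 : m ≠ 0 := hirr.ne_zero
  have hinj := (Int.castRingHom ℂ).injective_int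
  set mc := m.map (Int.castRingHom ℂ) with hmc
  have hmc0 : mc ≠ 0 := (Polynomial.map_ne_zero_iff hinj).mpr hm0
  set R := mc.roots with hR
  have hnodup : R.Nodup := nodup_roots_of_irreducible hirr (by omega)
  have hcard : Multiset.card R = 4 := by
    have hsp := (IsAlgClosed.splits mc).natDegree_eq_card_roots
    rw [hmc, natDegree_map_eq_of_injective hinj, hdeg] at hsp
    exact hsp.symm
  have hsplit : mc = (R.map fun β => X - C β).prod := (IsAlgClosed.splits mc).eq_prod_roots_of_monic (hmonic.map _)
  -- root facts
  have hinvR : ∀ β ∈ R, β⁻¹ ∈ R := fun β hβ => mem_roots_inv_of_reverse_eq hrev hm0 hβ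
  have hconjR : ∀ β ∈ R, conj β ∈ R := fun β hβ => mem_roots_conj hm0 hβ
  have hne : ∀ β ∈ R, β ≠ 0 ∧ β ≠ β⁻¹ := fun β hβ => root_ne_inv_of_irreducible hirr (by omega) hβ
  have hnoroot : ∀ t : ℤ, m.eval t ≠ 0 := by
    intro t ht
    have hdvd : X - C t ∣ m := dvd_iff_isRoot.mpr ht
    have hass : Associated (X - C t) m := (irreducible_X_sub_C t).associated_of_dvd hirr hdvd
    have h1 := natDegree_eq_of_degree_eq (degree_eq_degree_of_associated hass)
    rw [natDegree_X_sub_C] at h1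
    omega
  -- `M(m) = ∏ max(1, |β|)`
  have hM : intMahlerMeasure m = (R.map fun β => max 1 ‖β‖).prod := by
    unfold intMahlerMeasure
    rw [mahlerMeasure_eq_leadingCoeff_mul_prod_roots, (hmonic.map _).leadingCoeff, norm_one, one_mul]
  -- `|m(ε)| = ∏ |ε - β| ≥ 1` for `ε = ±1`
  have heval : ∀ ε : ℤ, ((m.eval ε : ℤ) : ℂ) = (R.map fun β => (ε : ℂ) - β).prod := by
    intro ε
    have : ((m.eval ε : ℤ) : ℂ) = mc.eval (ε : ℂ) := by
      rw [hmc, eval_intCast_map, eq_intCast, Int.cast_id]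
    rw [this, hsplit, eval_multiset_prod, Multiset.map_map]
    exact congrArg _ (Multiset.map_congr rfl fun β _ => by simp)
  have heval1 : ∀ ε : ℤ, (1 : ℝ) ≤ ‖(R.map fun β => (ε : ℂ) - β).prod‖ := by
    intro ε
    rw [← heval ε, Complex.norm_intCast]
    exact_mod_cast Int.one_le_abs (hnoroot ε)
  -- there is a root outside the unit circle
  have hout : ∃ α ∈ R, 1 < ‖α‖ := by
    by_contra hno
    push Not at hno
    have : intMahlerMeasure m = 1 := by
      rw [hM, Multiset.map_congr rfl (fun β hβ => max_eq_left (hno β hβ)), Multiset.map_const',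
        Multiset.prod_replicate, one_pow]
    linarith
  obtain ⟨α, hαR, hα1⟩ := hout
  have hα0 : α ≠ 0 := (hne α hαR).1
  have hαinvR : α⁻¹ ∈ R := hinvR α hαR
  have hαinv1 : ‖α⁻¹‖ < 1 := by rw [norm_inv]; exact inv_lt_one_of_one_lt₀ hα1
  by_cases hU : ∃ ζ ∈ R, ‖ζ‖ = 1
  · /- **Salem case.** Every root other than `α` lies in the closed disc (else five distinct roots),
    so `α` is real by `salem_structure_of_irreducible`, `M = |α|`, and `|m(±1)| ≤ 4 (|α|-1)²/|α| < 1`. -/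
    obtain ⟨ζ, hζR, hζ1⟩ := hU
    have hζinvR : ζ⁻¹ ∈ R := hinvR ζ hζR
    have hζne : ζ ≠ ζ⁻¹ := (hne ζ hζR).2
    have hothers : ∀ β ∈ R.erase α, ‖β‖ ≤ 1 := by
      intro β hβ
      have hβα : β ≠ α := ((Multiset.Nodup.mem_erase_iff hnodup).mp hβ).1
      have hβR : β ∈ R := Multiset.mem_of_mem_erase hβ
      by_contra hβ1
      push Not at hβ1
      -- five distinct roots `α, β, α⁻¹, β⁻¹, ζ`
      have hβinvR : β⁻¹ ∈ R := hinvR β hβR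
      have hβinv1 : ‖β⁻¹‖ < 1 := by rw [norm_inv]; exact inv_lt_one_of_one_lt₀ hβ1
      have hs : ({α, β, α⁻¹, β⁻¹, ζ} : Multiset ℂ) ≤ R := by
        rw [Multiset.le_iff_subset]
        · intro x hx
          simp only [Multiset.insert_eq_cons, Multiset.mem_cons, Multiset.mem_singleton] at hx
          rcases hx with rfl | rfl | rfl | rfl | rfl <;> assumption
        · simp only [Multiset.insert_eq_cons, Multiset.nodup_cons, Multiset.mem_cons, Multiset.mem_singleton,
            Multiset.nodup_singleton, and_true, not_or]
          refine ⟨⟨hβα.symm, ?_, ?_, ?_⟩, ⟨?_, ?_, ?_⟩, ⟨?_, ?_⟩, ?_⟩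
          · intro h; rw [h] at hα1; linarith
          · intro h; rw [h] at hα1; linarith
          · intro h; rw [h, hζ1] at hα1; linarith
          · intro h; rw [h] at hβ1; linarith
          · intro h; rw [h] at hβ1; linarith
          · intro h; rw [h, hζ1] at hβ1; linarith
          · intro h; exact hβα.symm (inv_injective h)
          · intro h; rw [h, hζ1] at hαinv1; linarith
          · intro h; rw [h, hζ1] at hβinv1; linarith
      have := Multiset.card_le_card hs
      rw [hcard] at this
      simp at this
    obtain ⟨-, -, hconj, -, hunit, hMα⟩ :=
      salem_structure_of_irreducible hirr hαR hα1 hothers hζR hζ1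
    rw [hmonic.leadingCoeff, Int.cast_one, abs_one, one_mul] at hMα
    -- `α` is real: `α = ±‖α‖`
    have hαre : α = (α.re : ℂ) := (Complex.conj_eq_iff_re.mp hconj).symm
    have hαabs : |α.re| = ‖α‖ := by
      conv_rhs => rw [hαre]
      rw [Complex.norm_real, Real.norm_eq_abs]
    -- the two remaining roots are in the closed disc
    set T := (R.erase α).erase α⁻¹ with hT
    have hαinvRe : α⁻¹ ∈ R.erase α := (Multiset.mem_erase_of_ne (hne α hαR).2.symm).mpr hαinvR
    have hRT : R = α ::ₘ α⁻¹ ::ₘ T := by rw [hT, Multiset.cons_erase hαinvRe, Multiset.cons_erase hαR]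
    have hTcard : Multiset.card T = 2 := by
      have := congrArg Multiset.card hRT
      rw [hcard, Multiset.card_cons, Multiset.card_cons] at this; omega
    have hTle : ∀ β ∈ T, ‖β‖ ≤ 1 := fun β hβ => hothers β (Multiset.mem_of_mem_erase hβ)
    -- `1 ≤ |m(ε)| ≤ |ε - α| · (|ε - α| / ‖α‖) · 4` for `ε = ±1`
    have hbound : ∀ ε : ℤ, ε = 1 ∨ ε = -1 → (1 : ℝ) ≤ ‖(ε : ℂ) - α‖ * (‖(ε : ℂ) - α‖ / ‖α‖) * 4 := by
      intro ε hε
      have hε1 : ‖(ε : ℂ)‖ = 1 := by rcases hε with h | h <;> simp [h]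
      have h := heval1 ε
      rw [hRT, Multiset.map_cons, Multiset.map_cons, Multiset.prod_cons, Multiset.prod_cons, norm_mul,
        norm_mul] at h
      have hT2 := norm_prod_sub_le_two_pow T (ε : ℂ) hε1 hTle
      rw [hTcard] at hT2
      have hinv : ‖(ε : ℂ) - α⁻¹‖ = ‖(ε : ℂ) - α‖ / ‖α‖ := by
        have : (ε : ℂ) - α⁻¹ = ((ε : ℂ) * α - 1) / α := by field_simp
        rw [this, norm_div]
        congr 1
        have hεα : (ε : ℂ) * α - 1 = (ε : ℂ) * (α - (ε : ℂ)) := by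
          rcases hε with h | h
          · simp [h]
          · simp [h]; ring
        rw [hεα, norm_mul, hε1, one_mul, norm_sub_rev]
      rw [hinv] at h
      calc (1 : ℝ) ≤ ‖(ε : ℂ) - α‖ * (‖(ε : ℂ) - α‖ / ‖α‖) * ‖(T.map fun β => (ε : ℂ) - β).prod‖ := by
            rw [mul_assoc]; exact h
        _ ≤ ‖(ε : ℂ) - α‖ * (‖(ε : ℂ) - α‖ / ‖α‖) * 4 := by
            apply mul_le_mul_of_nonneg_left (by norm_num at hT2 ⊢; exact hT2)
            positivity
    -- choose the sign of `α`
    have hr2 : ‖α‖ < 13248 / 10000 := by rw [← hMα]; exact h2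
    have hrpos : 0 < ‖α‖ := by linarith
    have key : ∀ ε : ℤ, (ε = 1 ∨ ε = -1) → ‖(ε : ℂ) - α‖ = ‖α‖ - 1 → False := by
      intro ε hε hn
      have h := hbound ε hε
      rw [hn] at h
      have h3 : (‖α‖ - 1) * ((‖α‖ - 1) / ‖α‖) * 4 = 4 * (‖α‖ - 1) ^ 2 / ‖α‖ := by ring
      rw [h3, le_div_iff₀ hrpos] at h
      nlinarith
    rcases le_or_gt 0 α.re with hpos | hneg
    · have hx : α.re = ‖α‖ := by rw [← hαabs, abs_of_nonneg hpos]
      apply key 1 (Or.inl rfl)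
      have : ((1 : ℤ) : ℂ) - α = (((1 - α.re : ℝ)) : ℂ) := by
        conv_lhs => rw [hαre]
        push_cast; ring
      rw [this, Complex.norm_real, Real.norm_eq_abs, hx, abs_of_nonpos (by linarith)]
      ring
    · have hx : α.re = -‖α‖ := by
        rw [abs_of_neg hneg] at hαabs; linarith
      apply key (-1) (Or.inr rfl)
      have : ((-1 : ℤ) : ℂ) - α = (((-1 - α.re : ℝ)) : ℂ) := by
        conv_lhs => rw [hαre]
        push_cast; ring
      rw [this, Complex.norm_real, Real.norm_eq_abs, hx, abs_of_nonneg (by linarith)]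
      ring
  · /- **No unimodular root.** Then exactly two roots `α, β` lie outside the unit circle. -/
    push Not at hU
    set O := R.filter fun β => 1 < ‖β‖ with hO
    set I := R.filter fun β => ‖β‖ < 1 with hI
    have hOI : O + I = R := by
      rw [hO, hI]
      have : R.filter (fun β => ‖β‖ < 1) = R.filter (fun β => ¬ 1 < ‖β‖) :=
        Multiset.filter_congr fun β hβ => by
          constructor
          · intro h; linarith
          · intro h; exact lt_of_le_of_ne (not_lt.mp h) (hU β hβ)
      rw [this, Multiset.filter_add_not]
    have hOnodup : O.Nodup := hnodup.filter _
    have hInodup : I.Nodup := hnodup.filter _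
    have hOI_le : Multiset.card O ≤ Multiset.card I := by
      have h : O.map (fun β => β⁻¹) ≤ I := by
        rw [Multiset.le_iff_subset (hOnodup.map inv_injective)]
        intro x hx
        obtain ⟨β, hβ, rfl⟩ := Multiset.mem_map.mp hx
        rw [hO, Multiset.mem_filter] at hβ
        rw [hI, Multiset.mem_filter]
        exact ⟨hinvR β hβ.1, by rw [norm_inv]; exact inv_lt_one_of_one_lt₀ hβ.2⟩
      simpa using Multiset.card_le_card h
    have hIO_le : Multiset.card I ≤ Multiset.card O := by
      have h : I.map (fun β => β⁻¹) ≤ O := by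
        rw [Multiset.le_iff_subset (hInodup.map inv_injective)]
        intro x hx
        obtain ⟨β, hβ, rfl⟩ := Multiset.mem_map.mp hx
        rw [hI, Multiset.mem_filter] at hβ
        rw [hO, Multiset.mem_filter]
        have hβ0 : β ≠ 0 := (hne β hβ.1).1
        exact ⟨hinvR β hβ.1, by rw [norm_inv]; exact one_lt_inv_iff₀.mpr ⟨norm_pos_iff.mpr hβ0, hβ.2⟩⟩
      simpa using Multiset.card_le_card h
    have hOcard : Multiset.card O = 2 := by
      have := congrArg Multiset.card hOI
      rw [Multiset.card_add, hcard] at this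
      omega
    obtain ⟨a₁, a₂, hOeq⟩ := Multiset.card_eq_two.mp hOcard
    have ha₁₂ : a₁ ≠ a₂ := by
      have := hOnodup; rw [hOeq] at this
      simpa using this
    have hmemO : ∀ x, x ∈ O ↔ x ∈ R ∧ 1 < ‖x‖ := fun x => by rw [hO, Multiset.mem_filter]
    have ha₁ := (hmemO a₁).mp (by rw [hOeq]; simp)
    have ha₂ := (hmemO a₂).mp (by rw [hOeq]; simp)
    -- `M = |a₁| |a₂|`
    have hMO : intMahlerMeasure m = ‖a₁‖ * ‖a₂‖ := by
      rw [hM, ← hOI, Multiset.map_add, Multiset.prod_add]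
      have h1 : (O.map fun β => max 1 ‖β‖) = O.map fun β => ‖β‖ :=
        Multiset.map_congr rfl fun β hβ => max_eq_right ((hmemO β).mp hβ).2.le
      have h2 : (I.map fun β => max 1 ‖β‖) = I.map fun _ => (1 : ℝ) :=
        Multiset.map_congr rfl fun β hβ => by
          rw [hI, Multiset.mem_filter] at hβ; exact max_eq_left hβ.2.le
      rw [h1, h2, Multiset.map_const', Multiset.prod_replicate, one_pow, mul_one, hOeq]
      simp
    -- conjugation preserves `O`
    have hconjO : ∀ x ∈ O, conj x ∈ O := by
      intro x hx
      rw [hmemO] at hx ⊢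
      exact ⟨hconjR x hx.1, by rw [Complex.norm_conj]; exact hx.2⟩
    have hconj_cases : ∀ x ∈ O, conj x = a₁ ∨ conj x = a₂ := by
      intro x hx
      have := hconjO x hx
      rw [hOeq] at this
      simpa using this
    by_cases hreal : conj a₁ = a₁
    · /- both dominant roots real ⇒ all roots real ⇒ Schinzel: `M² ≥ φ⁴` -/
      have hreal₂ : conj a₂ = a₂ := by
        rcases hconj_cases a₂ (by rw [hOeq]; simp) with h | h
        · exfalso; apply ha₁₂
          have := congrArg conj h
          rw [Complex.conj_conj, hreal] at this
          exact this.symm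
        · exact h
      have hallreal : ∀ γ ∈ R, γ.im = 0 := by
        intro γ hγ
        have hrealO : ∀ x ∈ O, conj x = x := by
          intro x hx; rw [hOeq] at hx
          simp at hx
          rcases hx with rfl | rfl
          · exact hreal
          · exact hreal₂
        rw [← hOI, Multiset.mem_add] at hγ
        rcases hγ with hγ | hγ
        · exact Complex.conj_eq_iff_im.mp (hrealO γ hγ)
        · -- `γ⁻¹ ∈ O` is real, hence so is `γ`
          rw [hI, Multiset.mem_filter] at hγ
          have hγ0 : γ ≠ 0 := (hne γ hγ.1).1
          have hγinvO : γ⁻¹ ∈ O := by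
            rw [hmemO]
            exact ⟨hinvR γ hγ.1, by rw [norm_inv]; exact one_lt_inv_iff₀.mpr ⟨norm_pos_iff.mpr hγ0, hγ.2⟩⟩
          have h := hrealO _ hγinvO
          rw [map_inv₀, inv_inj] at h
          exact Complex.conj_eq_iff_im.mp h
      have hc0 : m.coeff 0 ≠ 0 := by
        rw [coeff_zero_eq_eval_zero]; exact_mod_cast hnoroot 0
      have hS := goldenRatio_pow_le_mahlerMeasure_sq_of_totally_real hc0 (hnoroot 1)
        (by exact_mod_cast hnoroot (-1)) hallreal
      rw [hdeg] at hS
      have hφ : (16 : ℝ) / 10 < Real.goldenRatio := by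
        rw [Real.goldenRatio]
        have : (22 : ℝ) / 10 < Real.sqrt 5 := by
          rw [show (22 : ℝ) / 10 = Real.sqrt ((22/10)^2) by rw [Real.sqrt_sq (by norm_num)]]
          exact Real.sqrt_lt_sqrt (by norm_num) (by norm_num)
        linarith
      have hM0 : 0 ≤ intMahlerMeasure m := by linarith
      nlinarith [pow_le_pow_left₀ (by norm_num : (0:ℝ) ≤ 16/10) hφ.le 4]
    · /- `a₂ = conj a₁`: a complex pair outside; the trace `y = a₁ + a₁⁻¹` is a non-real root of
      `y² + ay + (b-2)` -/
      have hconj₁ : conj a₁ = a₂ := by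
        rcases hconj_cases a₁ (by rw [hOeq]; simp) with h | h
        · exact absurd h hreal
        · exact h
      have hnorm₂ : ‖a₂‖ = ‖a₁‖ := by rw [← hconj₁, Complex.norm_conj]
      set s := ‖a₁‖ with hs
      have hs1 : 1 < s := ha₁.2
      have hMs : intMahlerMeasure m = s ^ 2 := by rw [hMO, hnorm₂, sq]
      -- the quartic relation at `a₁`
      have hform := palindromic_quartic_eq hdeg hmonic hrev
      set a := m.coeff 3 with ha
      set b := m.coeff 2 with hb
      have ha₁0 : a₁ ≠ 0 := (hne a₁ ha₁.1).1
      have hroot : a₁ ^ 4 + (a : ℂ) * a₁ ^ 3 + (b : ℂ) * a₁ ^ 2 + (a : ℂ) * a₁ + 1 = 0 := by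
        have h := (mem_roots hmc0).mp ha₁.1
        rw [IsRoot.def, hmc, hform] at h
        simpa using h
      have hy := trace_root_quadratic ha₁0 hroot
      set y := a₁ + a₁⁻¹ with hydef
      have hy' : y ^ 2 + (a : ℂ) * y + ((b - 2 : ℤ) : ℂ) = 0 := by push_cast; exact hy
      -- `Im y = Im a₁ · (1 - 1/s²) ≠ 0` and `|Im y| ≤ s - 1/s`
      have hyim : y.im = a₁.im * (1 - (s ^ 2)⁻¹) := by
        rw [hydef, Complex.add_im, Complex.inv_im, Complex.normSq_eq_norm_sq, ← hs]
        ring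
      have ha₁im : a₁.im ≠ 0 := by
        intro h0
        apply hreal
        exact Complex.conj_eq_iff_im.mpr h0
      have hs2 : 1 < s ^ 2 := by nlinarith
      have hyim0 : y.im ≠ 0 := by
        rw [hyim]
        refine mul_ne_zero ha₁im ?_
        have : (s ^ 2)⁻¹ < 1 := inv_lt_one_of_one_lt₀ hs2
        linarith
      have him := im_sq_ge_of_int_quadratic hy' hyim0
      -- `|Im a₁| ≤ s`
      have hima : a₁.im ^ 2 ≤ s ^ 2 := by
        rw [hs, ← Complex.normSq_eq_norm_sq, Complex.normSq_apply]
        nlinarith [sq_nonneg a₁.re]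
      have hfac : 0 ≤ 1 - (s ^ 2)⁻¹ ∧ 1 - (s ^ 2)⁻¹ < 1 := by
        constructor
        · have : (s ^ 2)⁻¹ ≤ 1 := inv_le_one_of_one_le₀ hs2.le
          linarith
        · have : 0 < (s ^ 2)⁻¹ := by positivity
          linarith
      -- `(Im y)² = (Im a₁)² (1 - 1/s²)² ≤ s² (1 - 1/s²)² = (s² - 1)²/s² < (0.3248)²/1`
      have hs2' : s ^ 2 < 13248 / 10000 := by rw [← hMs]; exact h2
      have hyim2 : y.im ^ 2 ≤ s ^ 2 * (1 - (s ^ 2)⁻¹) ^ 2 := by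
        rw [hyim, mul_pow]
        exact mul_le_mul_of_nonneg_right hima (sq_nonneg _)
      have hcalc : s ^ 2 * (1 - (s ^ 2)⁻¹) ^ 2 = (s ^ 2 - 1) ^ 2 / s ^ 2 := by
        field_simp
      rw [hcalc] at hyim2
      have hlt : (s ^ 2 - 1) ^ 2 / s ^ 2 < 3 / 4 := by
        rw [div_lt_iff₀ (by positivity)]
        nlinarith
      linarith

end Summit.Ventures.DiscreteObjects.Mahler
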